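import Summits.AtomisticToContinuum.FouriersLaw.Theorems.JunctionLocalityNonBallisticLightConePropagationAux1
import Literature.MathematicalPhysics.KineticTheory.InfiniteChainLightConeProofs
import Literature.MathematicalPhysics.KineticTheory.VelocityFlipNoise

/-!
# Common-noise propagation bound for the flow of the pinned chain (piece FS-A of the light-cone window)

STATUS (worker FS-A, 2026-08-16): sorry-free, axioms standard; helpers landed as `…LightConePropagationAux1`
(p89361); this file carries the registered sub-goal `chainFlow_momentumFlip_propagation` (piece FS-A), whose inner
`∀ (i₀ : Fin N) …` statement is VERBATIM the hypothesis `hprop` of the lead's `sq_bondCurrent_diff_le_of_cone`.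

Helper (`--supports`) for the line `contact-current-forgetting` of the crux `JunctionLocality.NonBallistic`
(stmt-AtomisticToContinuum-9127), stub `stub_lightConeWindow` (LC). The stub is reduced (`…StubLightConeWindowAux3`,
`lightConeWindow_of_flipInsensitivity`) to the flip-insensitivity statement (FS), which compares two solutions of the
Langevin integral equation driven by the SAME noise path from `x` and from `x` with one contact momentum flipped. This
file is its DETERMINISTIC core, the finite-chain-with-baths analogue of Buttà–Marchioro's one-site perturbation
estimate (J. Stat. Phys. 164 (2016) 680, §4 (4.3)–(4.9), there for the infinite deterministic chain):

`chainFlow_momentumFlip_propagation` — there is `A = A(ω₂, lam, β, γ) > 0` (explicitly `3 + ω₂ + 3 lam + 24 β + 2γ`,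
`chainFlow_momentumFlip_propagation_explicit`) such that for the flows `z = chainFlow x η`, `z' = chainFlow (x^{i₀}) η`
(`x^{i₀} = momentumFlip i₀ x`, SAME continuous `η`) whose positions stay in `[-R, R]` (`R ≥ 1`) on `[0, t]`,

  `|q'_k(t) - q_k(t)| + |p'_k(t) - p_k(t)| ≤ 2 · (2|p_{i₀}|) · (1/2)^{k - i₀}`   whenever `2e · 3(A R²) t ≤ k - i₀`.

Proof: the noise cancels in the difference (`pinnedChain_chainFlow_sub_apply`, `…Aux1`); with
`u_k := |δq_k| + |δp_k|` extended by zero to `ℤ`, the `O(R²)`-Lipschitz bound of the cubic nearest-neighbour forces on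
the box (`pinnedChain_abs_drift_snd_sub_le`) gives `u_k(τ) ≤ u_k(0) + A R² ∫₀^τ (u_{k-1} + u_k + u_{k+1})`, with
`u_k(0) = 2|p_{i₀}| [k = i₀]`; the abstract Dobrushin–Fritz iteration `BMLightCone.lattice_iteration_far`
(`InfiniteChainLightConeProofs.lean`, weight `g ≡ 1`, a-priori bound from continuity on the compact `[0, t]`) concludes.
NOT here: any probability (the box hypothesis is discharged by energy/kinematic bounds under `μ_T ⊗ Wiener` in the
assembly of (FS)).
-/

noncomputable section

open MeasureTheory Set Filter Topology

namespace Summit.AtomisticToContinuum.FouriersLaw.Theorems.NonBallistic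

open Literature.MathematicalPhysics.KineticTheory.HeatConduction

namespace LightConePropagation

variable {N : ℕ} {ω₂ lam β γ : ℝ}

/-! ### The propagation bound -/

/-- **Common-noise propagation bound, explicit rate.** Two solutions of the Langevin integral equation of the
pinned chain driven by the SAME continuous noise path, started from `x` and from `x` with the momentum of site
`i₀` flipped, whose positions stay in `[-R, R]` (`R ≥ 1`) on `[0, t]`, differ at any site `k ≠ i₀` by at most
`2 · 2|p_{i₀}| · 2^{-|k - i₀|}` in the light-cone regime `2e · 3 (A R²) t ≤ |k - i₀|`,
`A = 3 + ω₂ + 3 lam + 24 β + 2γ`: the site deviations `u_k = |δq_k| + |δp_k|` (extended by zero to `ℤ`) obey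
`u_k(τ) ≤ u_k(0) + A R² ∫₀^τ (u_{k-1} + u_k + u_{k+1})`, and the abstract Dobrushin–Fritz iteration
`BMLightCone.lattice_iteration_far` (weight `g ≡ 1`) applies. [folklore] -/
theorem chainFlow_momentumFlip_propagation_explicit (hω : 0 < ω₂) (hl : 0 ≤ lam) (hβ : 0 ≤ β) (hγ : 0 ≤ γ)
    (N : ℕ) (i₀ : Fin N) (x : PhaseSpace N) {η : ℝ → Fin N → ℝ} (hη : Continuous η) {R t : ℝ}
    (hR : 1 ≤ R) (ht : 0 ≤ t)
    (hbox : ∀ s ∈ Icc 0 t, ∀ i : Fin N,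
      |((pinnedChain ω₂ lam β γ).chainFlow N x η s).1 i| ≤ R ∧
      |((pinnedChain ω₂ lam β γ).chainFlow N (momentumFlip i₀ x) η s).1 i| ≤ R)
    {k : Fin N} (hk : k ≠ i₀)
    (hθ : 2 * Real.exp 1 * (3 * ((3 + ω₂ + 3 * lam + 24 * β + 2 * γ) * R ^ 2) * t) ≤
      ((k : ℤ) - (i₀ : ℤ)).natAbs) :
    |((pinnedChain ω₂ lam β γ).chainFlow N (momentumFlip i₀ x) η t).1 k -
        ((pinnedChain ω₂ lam β γ).chainFlow N x η t).1 k| +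
      |((pinnedChain ω₂ lam β γ).chainFlow N (momentumFlip i₀ x) η t).2 k -
        ((pinnedChain ω₂ lam β γ).chainFlow N x η t).2 k| ≤
      2 * (2 * |x.2 i₀|) * (1 / 2) ^ ((k : ℤ) - (i₀ : ℤ)).natAbs := by
  have hk' : 1 ≤ ((k : ℤ) - (i₀ : ℤ)).natAbs := by have := Fin.val_ne_of_ne hk; omega
  -- the two flows, the site deviations `v` and their lattice extension `u`
  set z : ℝ → PhaseSpace N := (pinnedChain ω₂ lam β γ).chainFlow N x η with hz
  set z' : ℝ → PhaseSpace N := (pinnedChain ω₂ lam β γ).chainFlow N (momentumFlip i₀ x) η with hz'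
  set v : Fin N → ℝ → ℝ := fun j s => |(z' s).1 j - (z s).1 j| + |(z' s).2 j - (z s).2 j| with hv
  set u : ℤ → ℝ → ℝ := fun l s => ∑ j : Fin N, if (j : ℤ) = l then v j s else 0 with hu
  have hu_coe : ∀ (j : Fin N) (s : ℝ), u j s = v j s := fun j s => latticeSum_coe (fun j => v j s) j
  have hv0 : ∀ j s, 0 ≤ v j s := fun j s => add_nonneg (abs_nonneg _) (abs_nonneg _)
  have hu0 : ∀ l s, 0 ≤ u l s := fun l s => latticeSum_nonneg (fun j => hv0 j s) l
  have hd1 : ∀ (s : ℝ) (j : Fin N), |(z' s).1 j - (z s).1 j| ≤ u j s := fun s j => by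
    rw [hu_coe]; exact le_add_of_nonneg_right (abs_nonneg _)
  have hd2 : ∀ (s : ℝ) (j : Fin N), |(z' s).2 j - (z s).2 j| ≤ u j s := fun s j => by
    rw [hu_coe]; exact le_add_of_nonneg_left (abs_nonneg _)
  -- continuity
  have hzc : Continuous z := pinnedChain_continuous_chainFlow hω hl hβ hγ N x hη
  have hz'c : Continuous z' := pinnedChain_continuous_chainFlow hω hl hβ hγ N (momentumFlip i₀ x) hη
  have hYc : ∀ j, Continuous fun s => ((pinnedChain ω₂ lam β γ).drift N (z' s)).2 j -
      ((pinnedChain ω₂ lam β γ).drift N (z s)).2 j := fun j =>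
    (pinnedChain_continuous_chainFlow_apply hω hl hβ hγ N (momentumFlip i₀ x) hη j).2.2.sub
      (pinnedChain_continuous_chainFlow_apply hω hl hβ hγ N x hη j).2.2
  have hvc : ∀ j, Continuous (v j) := fun j =>
    (((continuous_apply j).comp (continuous_fst.comp hz'c)).sub
        ((continuous_apply j).comp (continuous_fst.comp hzc))).abs.add
      (((continuous_apply j).comp (continuous_snd.comp hz'c)).sub
        ((continuous_apply j).comp (continuous_snd.comp hzc))).abs
  have huc : ∀ l, Continuous (u l) := fun l => by
    refine continuous_finsetSum _ fun j _ => ?_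
    split_ifs
    · exact hvc j
    · exact continuous_const
  -- the a priori bound on `[0, t]`
  obtain ⟨M, hM⟩ := (isCompact_Icc (a := (0 : ℝ)) (b := t)).exists_bound_of_continuousOn
    (hz'c.sub hzc).continuousOn
  set B : ℝ := 2 * max M 0 with hB
  have hB0 : 0 ≤ B := by positivity
  have hvB : ∀ j, ∀ s ∈ Icc 0 t, v j s ≤ B := by
    intro j s hs
    have hn : ‖z' s - z s‖ ≤ M := hM s hs
    have h1 : |(z' s).1 j - (z s).1 j| ≤ M :=
      calc |(z' s).1 j - (z s).1 j| = ‖(z' s - z s).1 j‖ := by rw [Real.norm_eq_abs]; rfl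
        _ ≤ ‖(z' s - z s).1‖ := norm_le_pi_norm _ j
        _ ≤ ‖z' s - z s‖ := norm_fst_le _
        _ ≤ M := hn
    have h2 : |(z' s).2 j - (z s).2 j| ≤ M :=
      calc |(z' s).2 j - (z s).2 j| = ‖(z' s - z s).2 j‖ := by rw [Real.norm_eq_abs]; rfl
        _ ≤ ‖(z' s - z s).2‖ := norm_le_pi_norm _ j
        _ ≤ ‖z' s - z s‖ := norm_snd_le _
        _ ≤ M := hn
    calc v j s = |(z' s).1 j - (z s).1 j| + |(z' s).2 j - (z s).2 j| := rfl
      _ ≤ M + M := add_le_add h1 h2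
      _ ≤ B := by rw [hB]; linarith [le_max_left M 0]
  have hu_bd : ∀ l, ∀ s ∈ Icc 0 t, u l s ≤ B * 1 := fun l s hs => by
    rw [mul_one]; exact latticeSum_le hB0 (fun j => hvB j s hs) l
  -- initial data: only the momentum of site `i₀` differs, by `2|p_{i₀}|`
  have hz0 : z 0 = x + ((0 : Fin N → ℝ), η 0) := pinnedChain_chainFlow_of_nonpos ω₂ lam β γ N x hη le_rfl
  have hz'0 : z' 0 = momentumFlip i₀ x + ((0 : Fin N → ℝ), η 0) :=
    pinnedChain_chainFlow_of_nonpos ω₂ lam β γ N (momentumFlip i₀ x) hη le_rfl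
  have hv_init : ∀ j, v j 0 = if j = i₀ then 2 * |x.2 i₀| else 0 := by
    intro j
    simp only [hv, hz0, hz'0, Prod.fst_add, Prod.snd_add, Pi.add_apply, momentumFlip_fst, sub_self,
      abs_zero, zero_add, add_sub_add_right_eq_sub]
    by_cases hj : j = i₀
    · subst hj
      rw [if_pos rfl, momentumFlip_snd_self, show -x.2 j - x.2 j = -(2 * x.2 j) by ring, abs_neg, abs_mul,
        abs_two]
    · rw [if_neg hj, momentumFlip_snd_of_ne hj, sub_self, abs_zero]
  have hu_i : u i₀ 0 ≤ 2 * |x.2 i₀| := by rw [hu_coe, hv_init, if_pos rfl]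
  have hu_0 : ∀ l, l ≠ (i₀ : ℤ) → u l 0 ≤ 0 := by
    intro l hl0
    refine le_of_eq (Finset.sum_eq_zero fun j _ => ?_)
    split_ifs with h
    · have hj : j ≠ i₀ := fun hji => hl0 (by rw [← h, hji])
      rw [hv_init, if_neg hj]
    · rfl
  -- the rate
  set L : ℝ := ω₂ + 3 * lam * R ^ 2 + 2 * (1 + 12 * β * R ^ 2) + 2 * γ with hL
  set a : ℝ := (3 + ω₂ + 3 * lam + 24 * β + 2 * γ) * R ^ 2 with ha
  have hR2 : 1 ≤ R ^ 2 := one_le_pow₀ hR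
  have hKV0 : 0 ≤ 1 + 12 * β * R ^ 2 := by positivity
  have hKVL : 1 + 12 * β * R ^ 2 ≤ L := by rw [hL]; nlinarith
  have hL0 : 0 ≤ L := hKV0.trans hKVL
  have hLa : 1 + L ≤ a := by
    rw [hL, ha]
    nlinarith [mul_nonneg (show (0 : ℝ) ≤ 3 + ω₂ + 2 * γ by positivity) (show (0 : ℝ) ≤ R ^ 2 - 1 by linarith)]
  have ha0 : 0 ≤ a := by positivity
  -- the integral inequalities
  have hu_int : ∀ l, ∀ τ ∈ Icc 0 t, u l τ ≤ u l 0 +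
      a * 1 * ∫ s in (0 : ℝ)..τ, (u (l - 1) s + u l s + u (l + 1) s) := by
    intro l τ hτ
    rw [mul_one]
    have hW0 : ∀ s, 0 ≤ u (l - 1) s + u l s + u (l + 1) s := fun s =>
      add_nonneg (add_nonneg (hu0 _ s) (hu0 _ s)) (hu0 _ s)
    have hWc : Continuous fun s => u (l - 1) s + u l s + u (l + 1) s := ((huc _).add (huc _)).add (huc _)
    have hI0 : 0 ≤ ∫ s in (0 : ℝ)..τ, (u (l - 1) s + u l s + u (l + 1) s) :=
      intervalIntegral.integral_nonneg hτ.1 fun s _ => hW0 s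
    by_cases hex : ∃ j : Fin N, (j : ℤ) = l
    · obtain ⟨j, rfl⟩ := hex
      obtain ⟨hq, hp⟩ := pinnedChain_chainFlow_sub_apply hω hl hβ hγ N x (momentumFlip i₀ x) hη j hτ.1
      have hδ0 : (z' 0).1 j - (z 0).1 j = (momentumFlip i₀ x).1 j - x.1 j ∧
          (z' 0).2 j - (z 0).2 j = (momentumFlip i₀ x).2 j - x.2 j := by
        rw [hz0, hz'0]
        simp only [Prod.fst_add, Prod.snd_add, Pi.add_apply, Pi.zero_apply, add_zero, add_sub_add_right_eq_sub,
          and_self]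
      -- positions
      have h1 : |(z' τ).1 j - (z τ).1 j| ≤ |(z' 0).1 j - (z 0).1 j| +
          ∫ s in (0 : ℝ)..τ, (u (j - 1) s + u j s + u (j + 1) s) := by
        have hbd : |∫ s in (0 : ℝ)..τ, ((z' s).2 j - (z s).2 j)| ≤
            ∫ s in (0 : ℝ)..τ, (u (j - 1) s + u j s + u (j + 1) s) := by
          refine (intervalIntegral.abs_integral_le_integral_abs hτ.1).trans ?_
          refine intervalIntegral.integral_mono_on hτ.1 ?_ (hWc.intervalIntegrable _ _) fun s _ => ?_
          · exact ((((continuous_apply j).comp (continuous_snd.comp hz'c)).sub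
              ((continuous_apply j).comp (continuous_snd.comp hzc))).abs).intervalIntegrable _ _
          · have := hd2 s j
            linarith [hu0 ((j : ℤ) - 1) s, hu0 ((j : ℤ) + 1) s]
        have e : (z' τ).1 j - (z τ).1 j = ((z' 0).1 j - (z 0).1 j) +
            ∫ s in (0 : ℝ)..τ, ((z' s).2 j - (z s).2 j) := by rw [hδ0.1]; exact hq
        rw [e]
        exact (abs_add_le _ _).trans (by linarith)
      -- momenta
      have h2 : |(z' τ).2 j - (z τ).2 j| ≤ |(z' 0).2 j - (z 0).2 j| +
          L * ∫ s in (0 : ℝ)..τ, (u (j - 1) s + u j s + u (j + 1) s) := by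
        have hbd : |∫ s in (0 : ℝ)..τ, (((pinnedChain ω₂ lam β γ).drift N (z' s)).2 j -
              ((pinnedChain ω₂ lam β γ).drift N (z s)).2 j)| ≤
            ∫ s in (0 : ℝ)..τ, L * (u (j - 1) s + u j s + u (j + 1) s) := by
          refine (intervalIntegral.abs_integral_le_integral_abs hτ.1).trans ?_
          refine intervalIntegral.integral_mono_on hτ.1 ((hYc j).abs.intervalIntegrable _ _)
            ((hWc.const_mul L).intervalIntegrable _ _) fun s hs => ?_
          have hst : s ∈ Icc 0 t := ⟨hs.1, hs.2.trans hτ.2⟩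
          have hF := pinnedChain_abs_drift_snd_sub_le hω.le hl hβ hγ (z := z s) (z' := z' s) (R := R)
            (fun i => (hbox s hst i).1) (fun i => (hbox s hst i).2) (d := fun l => u l s)
            (fun l => hu0 l s) (hd1 s) (hd2 s) j
          refine hF.trans ?_
          rw [← hL]
          have hm := hu0 ((j : ℤ) - 1) s
          have hp' := hu0 ((j : ℤ) + 1) s
          nlinarith
        rw [intervalIntegral.integral_const_mul] at hbd
        have e : (z' τ).2 j - (z τ).2 j = ((z' 0).2 j - (z 0).2 j) +
            ∫ s in (0 : ℝ)..τ, (((pinnedChain ω₂ lam β γ).drift N (z' s)).2 j -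
              ((pinnedChain ω₂ lam β γ).drift N (z s)).2 j) := by rw [hδ0.2]; exact hp
        rw [e]
        exact (abs_add_le _ _).trans (by linarith)
      -- combine
      rw [hu_coe, hu_coe]
      calc v j τ = |(z' τ).1 j - (z τ).1 j| + |(z' τ).2 j - (z τ).2 j| := rfl
        _ ≤ (|(z' 0).1 j - (z 0).1 j| + |(z' 0).2 j - (z 0).2 j|) +
            (1 + L) * ∫ s in (0 : ℝ)..τ, (u (j - 1) s + u j s + u (j + 1) s) := by linarith
        _ ≤ v j 0 + a * ∫ s in (0 : ℝ)..τ, (u (j - 1) s + u j s + u (j + 1) s) :=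
            add_le_add le_rfl (mul_le_mul_of_nonneg_right hLa hI0)
    · push Not at hex
      have hul : ∀ s, u l s = 0 := fun s => latticeSum_of_forall_ne (fun j => v j s) hex
      rw [hul τ, hul 0]
      nlinarith
  -- the Dobrushin–Fritz iteration with the flat weight `g ≡ 1`
  have hθ' : 2 * Real.exp 1 * (3 * a * 1 * t) ≤ ((k : ℤ) - (i₀ : ℤ)).natAbs := by rwa [mul_one]
  have hit := BMLightCone.lattice_iteration_far (g := fun _ : ℕ => (1 : ℝ)) (u := u) (i := (i₀ : ℤ))
    (j := (k : ℤ)) (fun _ => le_rfl) monotone_const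
    (fun n => by have : (0 : ℝ) ≤ n := n.cast_nonneg; show (1 : ℝ) ≤ 3 + n; linarith)
    (fun m m' _ h => by show (m : ℝ) * 1 ≤ m' * 1; rw [mul_one, mul_one]; exact_mod_cast h)
    ht (by positivity) ha0 hB0 (fun l => (huc l).continuousOn) hu_bd hu_i hu_0 hu_int hk' hθ'
  rwa [hu_coe] at hit

end LightConePropagation

open LightConePropagation in
/-- **Common-noise propagation bound for the flow of the pinned chain** (piece FS-A of the flip-insensitivity
statement behind stub `stub_lightConeWindow`): there is a rate constant `A = A(ω₂, lam, β, γ) > 0` such that two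
solutions of the Langevin integral equation driven by the SAME continuous noise path `η`, from `x` and from `x` with
the momentum of site `i₀` flipped, whose positions stay in `[-R, R]` (`R ≥ 1`) on `[0, t]`, satisfy
`|δq_k(t)| + |δp_k(t)| ≤ 2 (2|p_{i₀}|) (1/2)^{k - i₀}` at every site `k > i₀` in the light-cone regime
`2e · 3 (A R²) t ≤ k - i₀` (nearest-neighbour cubic forces are `O(R²)`-Lipschitz on the box; abstract
Dobrushin–Fritz iteration `BMLightCone.lattice_iteration_far`). [folklore] -/
theorem chainFlow_momentumFlip_propagation :
    ∀ ω₂ lam β γ : ℝ, 0 < ω₂ → 0 ≤ lam → 0 ≤ β → 0 ≤ γ → ∃ A : ℝ, 0 < A ∧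
      ∀ (N : ℕ) (i₀ : Fin N) (x : PhaseSpace N) (η : ℝ → Fin N → ℝ), Continuous η →
      ∀ (R t : ℝ), 1 ≤ R → 0 ≤ t →
      (∀ s ∈ Set.Icc 0 t, ∀ i : Fin N,
          |((pinnedChain ω₂ lam β γ).chainFlow N x η s).1 i| ≤ R ∧
          |((pinnedChain ω₂ lam β γ).chainFlow N (momentumFlip i₀ x) η s).1 i| ≤ R) →
      ∀ k : Fin N, i₀.val < k.val → 2 * Real.exp 1 * (3 * (A * R ^ 2) * t) ≤ ((k.val - i₀.val : ℕ) : ℝ) →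
        |((pinnedChain ω₂ lam β γ).chainFlow N (momentumFlip i₀ x) η t).1 k -
            ((pinnedChain ω₂ lam β γ).chainFlow N x η t).1 k| +
          |((pinnedChain ω₂ lam β γ).chainFlow N (momentumFlip i₀ x) η t).2 k -
            ((pinnedChain ω₂ lam β γ).chainFlow N x η t).2 k|
            ≤ 2 * (2 * |x.2 i₀|) * (1 / 2) ^ (k.val - i₀.val) := by
  intro ω₂ lam β γ hω hl hβ hγ
  refine ⟨3 + ω₂ + 3 * lam + 24 * β + 2 * γ, by positivity, ?_⟩
  intro N i₀ x η hη R t hR ht hbox k hk hθ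
  have hD : ((k : ℤ) - (i₀ : ℤ)).natAbs = k.val - i₀.val := by omega
  have h := chainFlow_momentumFlip_propagation_explicit hω hl hβ hγ N i₀ x hη hR ht hbox
    (k := k) (fun h => by rw [h] at hk; exact lt_irrefl _ hk) (by rw [hD]; exact hθ)
  rwa [hD] at h

end Summit.AtomisticToContinuum.FouriersLaw.Theorems.NonBallistic
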